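import Summits.ValiantsHypothesis.ValiantsHypothesis.Theorems.GrenetZeonDualUnipotentThreeHalvesHeavyTopInvariantFlag
import Literature.Computability.AlgebraicComplexity.LRPencilOfMatrix

/-!
# MOR-valued pencils are flag-cheap (card `printed-irreducibles`, val-idea-31)

Mathes–Omladič–Radjavi 1991 §5: `MOR_{3k} = {[[0,T,0],[sI,0,T],[0,-sI,0]]} ⊂ M_{3k}(ℂ)` is an irreducible nilpotent space of
dimension `k²+1`.  Every affine pencil with values in it is `FlagCheap` at every format `n ≥ 4`, by the 3-level weight flag
`lvl i = 2 - i/k` (drop 1, climb 1) and `K = ker (linear part of the s-coordinate)`.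
-/

namespace Summit.ValiantsHypothesis.ValiantsHypothesis.Cruxes.DualUnipotentThreeHalves.IdeaSketch31Mor

open MvPolynomial Matrix
open scoped BigOperators
open Summit.ValiantsHypothesis.ValiantsHypothesis.Cruxes.TwoDimCoefficients.DimTwoCases (AffMat IsAffine)
open Summit.ValiantsHypothesis.ValiantsHypothesis.Theorems.GrenetZeon.RadicalSplit
open Summit.ValiantsHypothesis.ValiantsHypothesis.Theorems.GrenetZeon.HeavyTopInvariantFlag
  (flagCheap_of_weight_levels)

/-- Block index of a row/column of `M_{3k}`: `0, 1, 2`. -/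
def morBlk (k : ℕ) (i : Fin (3 * k)) : ℕ := (i : ℕ) / k

/-- Position inside the block. -/
def morPos (k : ℕ) (i : Fin (3 * k)) : ℕ := (i : ℕ) % k

/-- MOR's `M(s,T)`. -/
def morMat (k : ℕ) (s : ℂ) (T : Matrix (Fin k) (Fin k) ℂ) : Matrix (Fin (3 * k)) (Fin (3 * k)) ℂ :=
  fun i j =>
    if h : morBlk k i + 1 = morBlk k j ∧ morPos k i < k ∧ morPos k j < k then
      T ⟨morPos k i, h.2.1⟩ ⟨morPos k j, h.2.2⟩
    else if morBlk k i = morBlk k j + 1 ∧ morPos k i = morPos k j then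
      (if morBlk k i = 1 then s else -s)
    else 0

/-- The MOR space as a set of matrices. -/
def morSet (k : ℕ) : Set (Matrix (Fin (3 * k)) (Fin (3 * k)) ℂ) :=
  {M | ∃ (s : ℂ) (T : Matrix (Fin k) (Fin k) ℂ), M = morMat k s T}

theorem morBlk_le (k : ℕ) (hk : 1 ≤ k) (i : Fin (3 * k)) : morBlk k i ≤ 2 := by
  have : (i : ℕ) / k < 3 := (Nat.div_lt_iff_lt_mul (by omega)).mpr (by simpa [Nat.mul_comm] using i.isLt)
  unfold morBlk; omega

theorem morMat_eq_zero (k : ℕ) (s : ℂ) (T : Matrix (Fin k) (Fin k) ℂ) (i j : Fin (3 * k))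
    (h1 : morBlk k i + 1 ≠ morBlk k j) (h2 : ¬ (morBlk k i = morBlk k j + 1 ∧ morPos k i = morPos k j)) :
    morMat k s T i j = 0 := by
  unfold morMat
  rw [dif_neg (fun h => h1 h.1), if_neg h2]

theorem morMat_eq_s (k : ℕ) (s : ℂ) (T : Matrix (Fin k) (Fin k) ℂ) (i j : Fin (3 * k))
    (h1 : morBlk k i = morBlk k j + 1) (h2 : morPos k i = morPos k j) :
    morMat k s T i j = if morBlk k i = 1 then s else -s := by
  unfold morMat
  rw [dif_neg (fun h => by omega), if_pos ⟨h1, h2⟩]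

/-- **MOR-valued affine pencils are flag-cheap** at every format `n ≥ 4` (`k ≥ 1`). -/
theorem flagCheap_of_range_subset_mor (n k : ℕ) (hn : 4 ≤ n) (hk : 1 ≤ k) (N : AffMat n (3 * k))
    (hN : IsAffine N) (hrange : ∀ x : Fin n × Fin n → ℂ, N.map (MvPolynomial.eval x) ∈ morSet k) :
    FlagCheap n (3 * k) N := by
  classical
  -- the s-coordinate: row `k` (block 1, position 0), column `0`
  set i₁ : Fin (3 * k) := ⟨k, by omega⟩ with hi₁
  set j₀ : Fin (3 * k) := ⟨0, by omega⟩ with hj₀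
  have hb_i₁ : morBlk k i₁ = 1 := by simp [morBlk, hi₁, Nat.div_self (by omega : 0 < k)]
  have hb_j₀ : morBlk k j₀ = 0 := by simp [morBlk, hj₀]
  have hp_i₁ : morPos k i₁ = 0 := by simp [morPos, hi₁]
  have hp_j₀ : morPos k j₀ = 0 := by simp [morPos, hj₀]
  have hs : ∀ s T, morMat k s T i₁ j₀ = s := by
    intro s T
    rw [morMat_eq_s k s T i₁ j₀ (by rw [hb_i₁, hb_j₀]) (by rw [hp_i₁, hp_j₀]), if_pos hb_i₁]
  -- evaluation of an entry of the pencil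
  have hev : ∀ x s T, N.map (MvPolynomial.eval x) = morMat k s T → ∀ i j, eval x (N i j) = morMat k s T i j := by
    intro x s T h i j
    have := congrFun (congrFun h i) j
    simpa [Matrix.map_apply] using this
  -- the affine decomposition of the s-entry
  set a : ℂ := coeff 0 (N i₁ j₀) with ha
  set b : Fin n × Fin n → ℂ := fun c => coeff (Finsupp.single c 1) (N i₁ j₀) with hb
  have haff : ∀ w : Fin n × Fin n → ℂ, eval w (N i₁ j₀) = a + ∑ c, b c * w c := by
    intro w
    conv_lhs => rw [Literature.Computability.AlgebraicComplexity.LRPencil.eq_affine_of_totalDegree_le_one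
      (N i₁ j₀) (hN i₁ j₀)]
    simp [map_add, map_sum, map_mul, eval_C, eval_X, ha, hb]
  -- K = kernel of the linear part of the s-entry
  let ℓ : (Fin n × Fin n → ℂ) →ₗ[ℂ] ℂ := ∑ c, b c • LinearMap.proj c
  have hℓ : ∀ v, ℓ v = ∑ c, b c * v c := by
    intro v
    simp [ℓ, LinearMap.sum_apply, LinearMap.smul_apply, LinearMap.proj_apply, smul_eq_mul]
  let K : Submodule ℂ (Fin n × Fin n → ℂ) := LinearMap.ker ℓ
  have hKdim : n * n ≤ Module.finrank ℂ K + 1 := by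
    have h1 := LinearMap.finrank_range_add_finrank_ker ℓ
    have h2 : Module.finrank ℂ (Fin n × Fin n → ℂ) = n * n := by
      rw [Module.finrank_fintype_fun_eq_card, Fintype.card_prod, Fintype.card_fin]
    have h3 : Module.finrank ℂ (LinearMap.range ℓ) ≤ 1 := by
      have := (LinearMap.range ℓ).finrank_le
      rwa [Module.finrank_self] at this
    show n * n ≤ Module.finrank ℂ (LinearMap.ker ℓ) + 1
    omega
  -- budget arithmetic
  set q : ℕ := (3 - 1 + 1 * (n - 1)) / (1 + 1) with hq
  have hq2 : q * 2 ≤ n + 1 := by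
    have := Nat.div_mul_le_self (3 - 1 + 1 * (n - 1)) (1 + 1)
    rw [← hq] at this
    omega
  have hdim : (q + 1) * n < Module.finrank ℂ K := by
    have h1 : q * 2 * n ≤ (n + 1) * n := Nat.mul_le_mul_right n hq2
    have h2 : 4 * (n + 1) ≤ n * (n + 1) := Nat.mul_le_mul_right _ hn
    have h3 : (q + 1) * n + 2 ≤ n * n := by nlinarith [h1, h2]
    omega
  refine flagCheap_of_weight_levels N hN 1 (fun i => 2 - morBlk k i) 3 1 1 le_rfl (fun i => by omega)
    ?_ K ?_ q (by rw [hq]) hdim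
  · -- drop at most one level: only the (block 2, block 0) corner is constrained, and MOR vanishes there
    intro i j hlt
    have hbi := morBlk_le k hk i
    have hbj := morBlk_le k hk j
    have hbi2 : morBlk k i = 2 := by omega
    have hbj0 : morBlk k j = 0 := by omega
    simp only [inv_one, Units.val_one, Matrix.map_one C (map_zero C) (map_one C), Matrix.one_mul,
      Matrix.mul_one]
    apply MvPolynomial.funext
    intro x
    obtain ⟨s, T, hx⟩ := hrange x
    rw [map_zero, hev x s T hx i j]
    exact morMat_eq_zero k s T i j (by omega) (by omega)
  · -- climb at least one level on K
    intro v hv i j hlt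
    have hbi := morBlk_le k hk i
    have hbj := morBlk_le k hk j
    have hij : morBlk k j ≤ morBlk k i := by omega
    simp only [inv_one, Units.val_one, Matrix.one_mul, Matrix.mul_one]
    obtain ⟨s, T, hvx⟩ := hrange v
    obtain ⟨s₀, T₀, h0x⟩ := hrange 0
    have e1 : linPart N v i j = morMat k s T i j - morMat k s₀ T₀ i j := by
      simp only [linPart, Matrix.sub_apply, Matrix.map_apply]
      rw [hev v s T hvx i j, hev 0 s₀ T₀ h0x i j]
    rw [e1]
    by_cases hc : morBlk k i = morBlk k j + 1 ∧ morPos k i = morPos k j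
    · -- an s-position: the s-coordinates of N(v) and N(0) agree on K
      have hsv : s = a := by
        have := hev v s T hvx i₁ j₀
        rw [hs] at this
        rw [← this, haff v, ← hℓ v, LinearMap.mem_ker.mp hv, add_zero]
      have hs0 : s₀ = a := by
        have := hev 0 s₀ T₀ h0x i₁ j₀
        rw [hs] at this
        rw [← this, haff 0]
        simp
      rw [morMat_eq_s k s T i j hc.1 hc.2, morMat_eq_s k s₀ T₀ i j hc.1 hc.2, hsv, hs0, sub_self]
    · rw [morMat_eq_zero k s T i j (by omega) hc, morMat_eq_zero k s₀ T₀ i j (by omega) hc, sub_self]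

end Summit.ValiantsHypothesis.ValiantsHypothesis.Cruxes.DualUnipotentThreeHalves.IdeaSketch31Mor
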